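/-
Copyright (c) 2026 the pub-hodgecm-mathlib formalisation cell (harness21).  Prover seat hodgecm-mathlib-F0P3a-p01 (g31), req620 Track A «(D-RAM) FOUR-FRAME» squad
(MS ROAD A, STAGE B brick B3₂ «TYPE-2 STRATA TABLE» — the residual-family kills X5 and X9 of LH4-p04 (g2)'s sieve ★ `typeTwo_sieve`, through the DUAL Gram matrix (II)).  2026-09-04.
-/
import Summits.HodgeConjecture.HodgeConjecture.Theorems.F0P3cDyRamDiagonalTypeTwoExclX1        -- ★ p856168 (LH4-p04): `smul_dualFrame_col_mem` (`ϖ·U_D·e_j ∈ N`), `v_gramCore_le` (column 1, test 2); brings ★ PART 5 (`dualFrame_sandwich`, `gram_values_of_type`, `v_inv_map_pow`)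
import HarnessLib

/-!
# Crux `H413`, line LH4 «(D-RAM) FOUR-FRAME» road — unit U3_Laws (iii), MS ROAD A, STAGE B brick B3₂: THE DUAL-GRAM KILLS X5 AND X9
# (two residual families of the type-2 integer sieve whose Gram entry `G₀₁` is silent — equal term valuations — die on the DUAL Gram `ϖ·G⁻¹` instead:
# X5 on `(ϖG⁻¹)₁₁` («column 1, test 2», ★ `v_gramCore_le`), X9 on `(ϖG⁻¹)₁₂` («column 2, test 2», `v_dualGram12_le` below))

Cell `hodgecm-mathlib` (D-0151), FLOOR 0, crux item H413 = `stmt-HodgeConjecture-24833`, route of record `HCCMUnconditional`; squad F0∕P3c∕LH4 (req618∕req620).  THEOREMS ONLY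
(no `def`, no instance, no notation, no `sorry`, default heartbeats); lane `--supports stmt-HodgeConjecture-24833 --as helper` (count-neutral).  Consumer: LH4-p04 (g2)'s B3₂-γ
«shapes₂» = ★ `typeTwo_sieve` ∘ (X-kills) ∘ axis lemmas (CENSUS `F0/P3c/LH4/LH4-p04/g2/CENSUS-B3type2.v1.LH4p04g2.md` §1–§2; kills ★ so far: X1 p856168, X3 X4 X6 X7 p856158).

SETTING (as in ★ `F0P3cDyRamDiagonalTypeTwoExclX3467`).  `N = latt V`, `V = (1 0 0; x ϖ^b 0; y z ϖ^c)`, `x y z ∈ 𝒪`, NORMALISED, TYPE-2 POLARISABLE for a `σ`-fixed non-degenerate `diag D`;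
`σ` valuation-preserving, `|ϖ| = exp(−1)`, parity clause `hfix`.  With `W = V⁻¹` and the dual frame `U_D = D⁻¹(σV)^{−T}` (★ p855301): `G⁻¹ = V⁻¹·U_D`, so «`ϖG⁻¹` integral» ⟺
«`ϖ·U_D·e_j ∈ N` for every `j`» (★ `smul_dualFrame_col_mem`) ⟺ the three forward-substitution tests of ★ `mem_latt_hnf_iff` per column.
WHAT IS PROVED.
* §1 `v_dualGram12_le` — COLUMN 2, TEST 2 in closed form: `|σz·(σϖ^b)⁻¹·D₁⁻¹ + x·σ(u)·D₀⁻¹| ≤ exp(1 − b − c)` with `σ(u) = σxσz(σϖ^b)⁻¹ − σy` (`u = (xz − yϖ^b)∕ϖ^b`) — the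
  `(1,2)` entry of `ϖ·G⁻¹` is integral (twin of ★ `v_dualGram22_le`, same column, second clause).
* §2 ENGINE `gram_exponents` (one `D` throughout): under `v z = v(ϖ^k)`, `v(xz − yϖ^b) = v(ϖ^w)`, `|y| = 1`, `b ≥ 1` there are `n₀ n₁ n₂ : ℤ` (`|D_i| = exp 2n_i`) with the integer
  SANDWICH of ★ PART 5 in all three slots, and THREE ALTERNATIVES «equal term valuations OR both terms pass the test»: (I₀₁) `2n₁ − b = 2n₂ − k ∨ (2n₁ − b ≤ 0 ∧ 2n₂ − k ≤ 0)`;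
  (II₁₁) `2n₀ = 2n₁ ∨ (−2n₁ ≤ 1 − 2b ∧ −2n₀ ≤ 1 − 2b)` (★ `v_gramCore_le`); (II₁₂) `b − k − 2n₁ = b − w − 2n₀ ∨ (b − k − 2n₁ ≤ 1 − b − c ∧ b − w − 2n₀ ≤ 1 − b − c)` (§1).
* §3 THE KILLS by `omega`: `typeTwo_exclX5` (`3 ≤ b`, `c` even, `2b ≤ c`, `v z = v ϖ^{c−b+2}`, `|y| = 1`; `w = b` by the ultrametric inequality; pins `2n₀ = c`, `2n₁ = 2b − 2`, and
  (II₁₁)'s pass-branch reads `2 − 2b ≤ 1 − 2b` — absurd); `typeTwo_exclX9` (`1 ≤ b`, `c` odd, `2b + 1 ≤ c`, `v z = v ϖ^b`, `|y| = 1`, `v(xz − yϖ^b) = v ϖ^{c−b}`; pins `2n₀ = 2b`,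
  `2n₁ = c − 1`, and (II₁₂)'s terms have exponents `1 − c ≠ −c`, pass-branch `1 − c ≤ 1 − b − c` — absurd).  X8 (all three alternatives degenerate) and X2, X10, X11 (`v z` or `w`
  unpinned) are NOT in this file.
HONEST LABEL.  Count-neutral (`--supports`); nothing printed is asserted; (MS) stays a PROVER TARGET; the verdict of record for (D-RAM) stays PRINT [LanglandsShelstad1989 Thm. p. 484 ∕
Rogawski1990 Prop. 4.9.1 (a)] ∕ XL; `HC_CM` is proved only modulo the 7 printed citations (2 remaining named inputs: hLiu418 = `stmt-HodgeConjecture-24832`, h413 =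
`stmt-HodgeConjecture-24833`) until rung 0 closes.

## References
* [Jacobowitz1962] R. Jacobowitz, *Hermitian forms over local fields*, Amer. J. Math. 84 (1962), §4 (Gram matrices, duals), §7–§8 (unimodular and `ϖ`-modular lattices).
* [Serre1980Trees] J.-P. Serre, *Trees* (1980), Ch. II §1.1 (lattices `g·𝒪^N`, Hermite normal form).
-/

set_option autoImplicit false

noncomputable section

namespace Summit.HodgeConjecture.HodgeConjecture.Cruxes.H413.F0P3cDyRamDiagonalTypeTwoExclX59

open Matrix
open Literature.NumberTheory.Automorphic Literature.NumberTheory.Automorphic.HermitianLattice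
open Literature.NumberTheory.Automorphic.UnitaryLatticeTree
open Summit.HodgeConjecture.HodgeConjecture.Cruxes.H413.F0P3cDyRamDiagonalTorusDefs
open Summit.HodgeConjecture.HodgeConjecture.Cruxes.H413.F0P3cDyRamDiagonalStableLatticeHNF
open Summit.HodgeConjecture.HodgeConjecture.Cruxes.H413.F0P3cDyRamDiagonalHNFDualFrameValuesTypeTwo
open Summit.HodgeConjecture.HodgeConjecture.Cruxes.H413.F0P3cDyRamDiagonalTypeTwoExclX1
open scoped Valued WithZero Matrix MatrixGroups

variable {K : Type*} [Field K] [Valued K ℤᵐ⁰]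

/-! ## §1  Column 2, test 2 of the dual Gram matrix -/

/-- **COLUMN 2, TEST 2: `|σz·(σϖ^b)⁻¹·D₁⁻¹ + x·σ(u)·D₀⁻¹| ≤ exp(1 − b − c)`** (`σ(u) = σxσz(σϖ^b)⁻¹ − σy`) — the second forward-substitution clause of `ϖ·U_D·e₂ ∈ N`, i.e. the
`(1,2)` entry of `ϖ·G⁻¹` is integral. [cite: Jacobowitz1962, §4, §7–§8] [cite: Serre1980Trees, II §1.1] -/
theorem v_dualGram12_le {σ : K →+* K} (hvσ : ∀ a, Valued.v (σ a) = Valued.v a) {ϖ : K} (hϖ : Valued.v ϖ = WithZero.exp (-1 : ℤ))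
    {D : Fin 3 → K} (hD0 : ∀ i, D i ≠ 0) (b c : ℕ) (x y z : K) {d : ℕ}
    (hM : IsVertexLattice σ ϖ (Matrix.diagonal D) d (latt (Matrix.of ![![1, 0, 0], ![x, ϖ ^ b, 0], ![y, z, ϖ ^ c]]))) :
    Valued.v (σ z * ((σ ϖ ^ b)⁻¹ * (D 1)⁻¹) + x * ((σ x * σ z * (σ ϖ ^ b)⁻¹ - σ y) * (D 0)⁻¹)) ≤ WithZero.exp (1 - (b : ℤ) - c) := by
  have hϖ0 : ϖ ≠ 0 := (Valuation.ne_zero_iff Valued.v).1 (by rw [hϖ]; exact WithZero.exp_ne_zero)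
  have hmem := smul_dualFrame_col_mem hvσ hϖ0 hD0 b c x y z hM 2
  rw [mem_latt_hnf_iff x y z (pow_ne_zero b hϖ0) (pow_ne_zero c hϖ0)] at hmem
  obtain ⟨-, h2, -⟩ := hmem
  simp only [Pi.smul_apply, smul_eq_mul, Matrix.mulVec_single_one, Matrix.col_apply] at h2
  have hid : ϖ * ((!![(D 0)⁻¹, -σ x * (σ ϖ ^ b)⁻¹ * (D 0)⁻¹, (σ x * σ z * (σ ϖ ^ b)⁻¹ - σ y) * (σ ϖ ^ c)⁻¹ * (D 0)⁻¹;
        0, (σ ϖ ^ b)⁻¹ * (D 1)⁻¹, -σ z * (σ ϖ ^ b)⁻¹ * (σ ϖ ^ c)⁻¹ * (D 1)⁻¹;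
        0, 0, (σ ϖ ^ c)⁻¹ * (D 2)⁻¹] : Matrix (Fin 3) (Fin 3) K) 1 2) -
      x * (ϖ * ((!![(D 0)⁻¹, -σ x * (σ ϖ ^ b)⁻¹ * (D 0)⁻¹, (σ x * σ z * (σ ϖ ^ b)⁻¹ - σ y) * (σ ϖ ^ c)⁻¹ * (D 0)⁻¹;
        0, (σ ϖ ^ b)⁻¹ * (D 1)⁻¹, -σ z * (σ ϖ ^ b)⁻¹ * (σ ϖ ^ c)⁻¹ * (D 1)⁻¹;
        0, 0, (σ ϖ ^ c)⁻¹ * (D 2)⁻¹] : Matrix (Fin 3) (Fin 3) K) 0 2)) =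
      -(ϖ * (σ ϖ ^ c)⁻¹) * (σ z * ((σ ϖ ^ b)⁻¹ * (D 1)⁻¹) + x * ((σ x * σ z * (σ ϖ ^ b)⁻¹ - σ y) * (D 0)⁻¹)) := by
    change ϖ * (-σ z * (σ ϖ ^ b)⁻¹ * (σ ϖ ^ c)⁻¹ * (D 1)⁻¹) - x * (ϖ * ((σ x * σ z * (σ ϖ ^ b)⁻¹ - σ y) * (σ ϖ ^ c)⁻¹ * (D 0)⁻¹)) = _
    ring
  rw [hid, Valuation.map_mul, Valuation.map_neg] at h2
  have hcoef : Valued.v (ϖ * (σ ϖ ^ c)⁻¹) = WithZero.exp (-1 + (c : ℤ)) := by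
    rw [map_mul, hϖ, v_inv_map_pow hvσ hϖ, ← WithZero.exp_add]
  have hq : Valued.v (ϖ ^ b) = WithZero.exp (-(b : ℤ)) := by
    rw [map_pow, hϖ, ← WithZero.exp_nsmul, nsmul_eq_mul, mul_neg, mul_one]
  rw [hcoef, hq] at h2
  have hne : WithZero.exp (-1 + (c : ℤ)) ≠ 0 := WithZero.exp_ne_zero
  calc Valued.v (σ z * ((σ ϖ ^ b)⁻¹ * (D 1)⁻¹) + x * ((σ x * σ z * (σ ϖ ^ b)⁻¹ - σ y) * (D 0)⁻¹))
      = (WithZero.exp (-1 + (c : ℤ)))⁻¹ * (WithZero.exp (-1 + (c : ℤ)) *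
          Valued.v (σ z * ((σ ϖ ^ b)⁻¹ * (D 1)⁻¹) + x * ((σ x * σ z * (σ ϖ ^ b)⁻¹ - σ y) * (D 0)⁻¹))) := by
        rw [inv_mul_cancel_left₀ hne]
    _ ≤ (WithZero.exp (-1 + (c : ℤ)))⁻¹ * WithZero.exp (-(b : ℤ)) := mul_le_mul' le_rfl h2
    _ = WithZero.exp (1 - (b : ℤ) - c) := by
        rw [← WithZero.exp_neg, ← WithZero.exp_add]; congr 1; omega

/-! ## §2  The full engine: pinned exponents in the three slots and the three alternatives -/

/-- **ENGINE (one `D` throughout).**  For a normalised type-2-polarisable HNF lattice with `v z = v(ϖ^k)`, `v(xz − yϖ^b) = v(ϖ^w)`, `|y| = 1`, `b ≥ 1`: integers `n₀ n₁ n₂`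
(`|D_i| = exp 2n_i`) with ★ PART 5's integer sandwich in slots 0, 1, 2 and the alternatives (I₀₁) (★ `gram_values_of_type`), (II₁₁) (★ `v_gramCore_le`), (II₁₂) (`v_dualGram12_le`):
in each, EITHER the two terms have equal valuation OR both pass the test. [cite: Jacobowitz1962, §4, §7–§8] [cite: Serre1980Trees, II §1.1] -/
theorem gram_exponents {σ : K →+* K} (hvσ : ∀ a, Valued.v (σ a) = Valued.v a)
    (hfix : ∀ t : K, σ t = t → t ≠ 0 → ∃ n : ℤ, Valued.v t = WithZero.exp (2 * n))
    {ϖ : K} (hϖ : Valued.v ϖ = WithZero.exp (-1 : ℤ)) (b c : ℕ) {x y z : K}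
    (hx : Valued.v x ≤ 1) (hy : Valued.v y ≤ 1) (hz : Valued.v z ≤ 1)
    (hn : IsNormalisedLattice (latt (Matrix.of ![![1, 0, 0], ![x, ϖ ^ b, 0], ![y, z, ϖ ^ c]])))
    (hpol : ∃ D : Fin 3 → K, (∀ i, σ (D i) = D i ∧ D i ≠ 0) ∧
      IsVertexLattice σ ϖ (Matrix.diagonal D) 2 (latt (Matrix.of ![![1, 0, 0], ![x, ϖ ^ b, 0], ![y, z, ϖ ^ c]])))
    {k w : ℕ} (hzk : Valued.v z = Valued.v (ϖ ^ k)) (hw : Valued.v (x * z - y * ϖ ^ b) = Valued.v (ϖ ^ w)) (hy1 : Valued.v y = 1) (hb : 1 ≤ b) :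
    ∃ n₀ n₁ n₂ : ℤ,
      ((b : ℤ) - 1 ≤ 2 * n₀ ∧ (b : ℤ) + c - w - 1 ≤ 2 * n₀ ∧ (2 * n₀ ≤ 0 ∨ 2 * n₀ ≤ (b : ℤ) ∨ 2 * n₀ ≤ (b : ℤ) + c - w)) ∧
      ((b : ℤ) - 1 ≤ 2 * n₁ ∧ (b : ℤ) + c - k - 1 ≤ 2 * n₁ ∧ (2 * n₁ ≤ (b : ℤ) ∨ 2 * n₁ ≤ (b : ℤ) + c - k)) ∧
      ((c : ℤ) - 1 ≤ 2 * n₂ ∧ 2 * n₂ ≤ (c : ℤ)) ∧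
      (2 * n₁ - (b : ℤ) = 2 * n₂ - k ∨ (2 * n₁ - (b : ℤ) ≤ 0 ∧ 2 * n₂ - (k : ℤ) ≤ 0)) ∧
      (2 * n₀ = 2 * n₁ ∨ (-(2 * n₁) ≤ 1 - 2 * (b : ℤ) ∧ -(2 * n₀) ≤ 1 - 2 * (b : ℤ))) ∧
      ((b : ℤ) - k - 2 * n₁ = (b : ℤ) - w - 2 * n₀ ∨
        ((b : ℤ) - k - 2 * n₁ ≤ 1 - (b : ℤ) - c ∧ (b : ℤ) - w - 2 * n₀ ≤ 1 - (b : ℤ) - c)) := by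
  obtain ⟨D, hD, hM⟩ := hpol
  have hD0 : ∀ i, D i ≠ 0 := fun i => (hD i).2
  have hvD0 : ∀ i, Valued.v (D i) ≠ 0 := fun i => (Valuation.ne_zero_iff _).2 (hD0 i)
  have hϖ0 : ϖ ≠ 0 := (Valuation.ne_zero_iff Valued.v).1 (by rw [hϖ]; exact WithZero.exp_ne_zero)
  have hq : ∀ n : ℕ, Valued.v (ϖ ^ n) = WithZero.exp (-(n : ℤ)) := fun n => by
    rw [map_pow, hϖ, ← WithZero.exp_nsmul, nsmul_eq_mul, mul_neg, mul_one]
  have hq1 : ∀ n : ℕ, Valued.v (ϖ ^ n) ≤ 1 := fun n => by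
    rw [hq, ← WithZero.exp_zero, WithZero.exp_le_exp]; omega
  -- normalisation at `b ≥ 1`: `|x| = 1`
  have hN := (normalised_latt_hnf_iff hx hy hz (hq1 b) (hq1 c)).1 hn
  have hx1 : Valued.v x = 1 := hN.1.resolve_left fun h => by
    rw [hq, ← WithZero.exp_zero, WithZero.exp_inj] at h; omega
  -- parity
  obtain ⟨n₀, hn₀⟩ := hfix (D 0) (hD 0).1 (hD0 0)
  obtain ⟨n₁, hn₁⟩ := hfix (D 1) (hD 1).1 (hD0 1)
  obtain ⟨n₂, hn₂⟩ := hfix (D 2) (hD 2).1 (hD0 2)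
  -- ★ PART 5 sandwich, Gram `(0,1)`, dual Gram `(1,1)` and `(1,2)`
  obtain ⟨⟨h2l, h2u⟩, ⟨h1l, h1z, h1u⟩, ⟨-, h0x, h0w, h0u⟩⟩ := dualFrame_sandwich hvσ hϖ hD0 b c hn hM
  have hG01 := (gram_values_of_type hvσ hϖ0 D b c x y z hM).2.1
  have hT2 := v_gramCore_le hvσ hϖ hD0 b c x y z hM
  have hT12 := v_dualGram12_le hvσ hϖ hD0 b c x y z hM
  refine ⟨n₀, n₁, n₂, ⟨?_, ?_, ?_⟩, ⟨?_, ?_, ?_⟩, ⟨?_, ?_⟩, ?_, ?_, ?_⟩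
  -- slot 0
  · rw [hϖ, hn₀, hx1, one_mul, ← WithZero.exp_add, WithZero.exp_le_exp] at h0x; omega
  · rw [hϖ, hn₀, hw, hq, ← WithZero.exp_add, ← WithZero.exp_add, WithZero.exp_le_exp] at h0w; omega
  · rcases h0u with h | h | h
    · left; rw [hn₀, ← WithZero.exp_zero, WithZero.exp_le_exp] at h; exact h
    · right; left; rw [hn₀, hx1, one_mul, WithZero.exp_le_exp] at h; exact h
    · right; right; rw [hn₀, hw, hq, ← WithZero.exp_add, WithZero.exp_le_exp] at h; omega
  -- slot 1
  · rw [hϖ, hn₁, ← WithZero.exp_add, WithZero.exp_le_exp] at h1l; omega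
  · rw [hϖ, hn₁, hzk, hq, ← WithZero.exp_add, ← WithZero.exp_add, WithZero.exp_le_exp] at h1z; omega
  · rcases h1u with h | h
    · left; rw [hn₁, WithZero.exp_le_exp] at h; exact h
    · right; rw [hn₁, hzk, hq, ← WithZero.exp_add, WithZero.exp_le_exp] at h; omega
  -- slot 2
  · rw [hϖ, hn₂, ← WithZero.exp_add, WithZero.exp_le_exp] at h2l; omega
  · rw [hn₂, WithZero.exp_le_exp] at h2u; exact h2u
  -- (I₀₁)
  · have hA : Valued.v (σ x * D 1 * ϖ ^ b) = WithZero.exp (2 * n₁ - b) := by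
      rw [map_mul, map_mul, hvσ, hx1, one_mul, hn₁, hq, ← WithZero.exp_add, ← sub_eq_add_neg]
    have hB : Valued.v (σ y * D 2 * z) = WithZero.exp (2 * n₂ - k) := by
      rw [map_mul, map_mul, hvσ, hy1, one_mul, hn₂, hzk, hq, ← WithZero.exp_add, ← sub_eq_add_neg]
    by_cases heq : 2 * n₁ - (b : ℤ) = 2 * n₂ - k
    · exact Or.inl heq
    · right
      have hne : Valued.v (σ x * D 1 * ϖ ^ b) ≠ Valued.v (σ y * D 2 * z) := by
        rw [hA, hB]; exact fun h => heq (WithZero.exp_injective h)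
      rw [Valuation.map_add_of_distinct_val _ hne, max_le_iff, hA, hB, ← WithZero.exp_zero, WithZero.exp_le_exp, WithZero.exp_le_exp] at hG01
      exact hG01
  -- (II₁₁)
  · have hA : Valued.v (D 0) = WithZero.exp (2 * n₀) := hn₀
    have hB : Valued.v (x * σ x * D 1) = WithZero.exp (2 * n₁) := by
      rw [map_mul, map_mul, hvσ, hx1, one_mul, one_mul, hn₁]
    by_cases heq : 2 * n₀ = 2 * n₁
    · exact Or.inl heq
    · right
      have hne : Valued.v (D 0) ≠ Valued.v (x * σ x * D 1) := by
        rw [hA, hB]; exact fun h => heq (WithZero.exp_injective h)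
      rw [Valuation.map_add_of_distinct_val _ hne] at hT2
      have hT2a := le_trans (mul_le_mul' (le_max_left _ _) le_rfl) hT2
      have hT2b := le_trans (mul_le_mul' (le_max_right _ _) le_rfl) hT2
      rw [hA, hn₁, ← WithZero.exp_neg, ← WithZero.exp_neg, ← WithZero.exp_add, ← WithZero.exp_add, WithZero.exp_le_exp] at hT2a
      rw [hB, hA, hn₁, ← WithZero.exp_neg, ← WithZero.exp_neg, ← WithZero.exp_add, ← WithZero.exp_add, WithZero.exp_le_exp] at hT2b
      constructor <;> omega
  -- (II₁₂)
  · have hσb : σ ϖ ^ b ≠ 0 := pow_ne_zero _ ((map_ne_zero σ).2 hϖ0)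
    have hS : σ x * σ z * (σ ϖ ^ b)⁻¹ - σ y = σ (x * z - y * ϖ ^ b) * (σ ϖ ^ b)⁻¹ := by
      rw [map_sub, map_mul, map_mul, map_pow, sub_mul, mul_assoc (σ y), mul_inv_cancel₀ hσb, mul_one]
    have hA : Valued.v (σ z * ((σ ϖ ^ b)⁻¹ * (D 1)⁻¹)) = WithZero.exp ((b : ℤ) - k - 2 * n₁) := by
      rw [map_mul, map_mul, hvσ, hzk, hq, v_inv_map_pow hvσ hϖ, map_inv₀, hn₁, ← WithZero.exp_neg, ← WithZero.exp_add,
        ← WithZero.exp_add]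
      congr 1; omega
    have hB : Valued.v (x * ((σ x * σ z * (σ ϖ ^ b)⁻¹ - σ y) * (D 0)⁻¹)) = WithZero.exp ((b : ℤ) - w - 2 * n₀) := by
      rw [hS, map_mul, map_mul, map_mul, hx1, one_mul, hvσ, hw, hq, v_inv_map_pow hvσ hϖ, map_inv₀, hn₀, ← WithZero.exp_neg,
        ← WithZero.exp_add, ← WithZero.exp_add]
      congr 1; omega
    by_cases heq : (b : ℤ) - k - 2 * n₁ = (b : ℤ) - w - 2 * n₀
    · exact Or.inl heq
    · right
      have hne : Valued.v (σ z * ((σ ϖ ^ b)⁻¹ * (D 1)⁻¹)) ≠ Valued.v (x * ((σ x * σ z * (σ ϖ ^ b)⁻¹ - σ y) * (D 0)⁻¹)) := by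
        rw [hA, hB]; exact fun h => heq (WithZero.exp_injective h)
      rw [Valuation.map_add_of_distinct_val _ hne, max_le_iff, hA, hB, WithZero.exp_le_exp, WithZero.exp_le_exp] at hT12
      exact hT12

/-! ## §3  The two dual-Gram kills -/

/-- **X5 IS EMPTY**: no normalised type-2-polarisable HNF lattice has `3 ≤ b`, `c` even, `2b ≤ c`, `v z = v(ϖ^{c−b+2})`, `|y| = 1` — `(ϖG⁻¹)₁₁` fails: `|D₀| = exp c`,
`|D₁| = exp(2b−2)`, `|D₀ + N(x)D₁|·|D₀|⁻¹·|D₁|⁻¹ = exp(2 − 2b) > exp(1 − 2b)`. [cite: Jacobowitz1962, §4, §7–§8] -/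
theorem typeTwo_exclX5 {σ : K →+* K} (hvσ : ∀ a, Valued.v (σ a) = Valued.v a)
    (hfix : ∀ t : K, σ t = t → t ≠ 0 → ∃ n : ℤ, Valued.v t = WithZero.exp (2 * n))
    {ϖ : K} (hϖ : Valued.v ϖ = WithZero.exp (-1 : ℤ)) (b c : ℕ) {x y z : K}
    (hx : Valued.v x ≤ 1) (hy : Valued.v y ≤ 1) (hz : Valued.v z ≤ 1)
    (hn : IsNormalisedLattice (latt (Matrix.of ![![1, 0, 0], ![x, ϖ ^ b, 0], ![y, z, ϖ ^ c]])))
    (hpol : ∃ D : Fin 3 → K, (∀ i, σ (D i) = D i ∧ D i ≠ 0) ∧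
      IsVertexLattice σ ϖ (Matrix.diagonal D) 2 (latt (Matrix.of ![![1, 0, 0], ![x, ϖ ^ b, 0], ![y, z, ϖ ^ c]])))
    (hX : 3 ≤ b ∧ c % 2 = 0 ∧ 2 * b ≤ c ∧ Valued.v z = Valued.v (ϖ ^ (c - b + 2)) ∧ Valued.v y = 1) : False := by
  obtain ⟨hb, hc2, hbc, hzk, hy1⟩ := hX
  have hq : ∀ n : ℕ, Valued.v (ϖ ^ n) = WithZero.exp (-(n : ℤ)) := fun n => by
    rw [map_pow, hϖ, ← WithZero.exp_nsmul, nsmul_eq_mul, mul_neg, mul_one]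
  -- `w = b`: `|xz| ≤ |z| = exp(−(c−b+2)) < exp(−b) = |yϖ^b|`
  have hw : Valued.v (x * z - y * ϖ ^ b) = Valued.v (ϖ ^ b) := by
    have hlt : Valued.v (x * z) < Valued.v (y * ϖ ^ b) := by
      rw [map_mul, map_mul, hy1, one_mul, hzk, hq, hq]
      calc Valued.v x * WithZero.exp (-((c - b + 2 : ℕ) : ℤ)) ≤ 1 * WithZero.exp (-((c - b + 2 : ℕ) : ℤ)) := mul_le_mul' hx le_rfl
        _ = WithZero.exp (-((c - b + 2 : ℕ) : ℤ)) := one_mul _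
        _ < WithZero.exp (-(b : ℤ)) := by rw [WithZero.exp_lt_exp]; omega
    rw [Valuation.map_sub_eq_of_lt_right _ hlt, map_mul, hy1, one_mul]
  obtain ⟨n₀, n₁, n₂, ⟨h0x, h0w, h0u⟩, ⟨h1l, h1z, h1u⟩, ⟨h2l, h2u⟩, hI, hII11, hII12⟩ :=
    gram_exponents hvσ hfix hϖ b c hx hy hz hn hpol hzk hw hy1 (by omega)
  have hk : ((c - b + 2 : ℕ) : ℤ) = (c : ℤ) - b + 2 := by omega
  rw [hk] at h1z h1u hI hII12
  omega

/-- **X9 IS EMPTY**: no normalised type-2-polarisable HNF lattice has `1 ≤ b`, `c` odd, `2b + 1 ≤ c`, `v z = v(ϖ^b)`, `|y| = 1`, `v(xz − yϖ^b) = v(ϖ^{c−b})` — `(ϖG⁻¹)₁₂` fails: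
`|D₀| = exp 2b`, `|D₁| = exp(c−1)`, the two terms of column 2's second test have exponents `1 − c ≠ −c`, and `1 − c ≤ 1 − b − c` is absurd. [cite: Jacobowitz1962, §4, §7–§8] -/
theorem typeTwo_exclX9 {σ : K →+* K} (hvσ : ∀ a, Valued.v (σ a) = Valued.v a)
    (hfix : ∀ t : K, σ t = t → t ≠ 0 → ∃ n : ℤ, Valued.v t = WithZero.exp (2 * n))
    {ϖ : K} (hϖ : Valued.v ϖ = WithZero.exp (-1 : ℤ)) (b c : ℕ) {x y z : K}
    (hx : Valued.v x ≤ 1) (hy : Valued.v y ≤ 1) (hz : Valued.v z ≤ 1)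
    (hn : IsNormalisedLattice (latt (Matrix.of ![![1, 0, 0], ![x, ϖ ^ b, 0], ![y, z, ϖ ^ c]])))
    (hpol : ∃ D : Fin 3 → K, (∀ i, σ (D i) = D i ∧ D i ≠ 0) ∧
      IsVertexLattice σ ϖ (Matrix.diagonal D) 2 (latt (Matrix.of ![![1, 0, 0], ![x, ϖ ^ b, 0], ![y, z, ϖ ^ c]])))
    (hX : 1 ≤ b ∧ c % 2 = 1 ∧ 2 * b + 1 ≤ c ∧ Valued.v z = Valued.v (ϖ ^ b) ∧ Valued.v y = 1 ∧
      Valued.v (x * z - y * ϖ ^ b) = Valued.v (ϖ ^ (c - b))) : False := by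
  obtain ⟨hb, hc2, hbc, hzk, hy1, hw⟩ := hX
  obtain ⟨n₀, n₁, n₂, ⟨h0x, h0w, h0u⟩, ⟨h1l, h1z, h1u⟩, ⟨h2l, h2u⟩, hI, hII11, hII12⟩ :=
    gram_exponents hvσ hfix hϖ b c hx hy hz hn hpol hzk hw hy1 hb
  have hk : ((c - b : ℕ) : ℤ) = (c : ℤ) - b := by omega
  rw [hk] at h0w h0u hII12
  omega

end Summit.HodgeConjecture.HodgeConjecture.Cruxes.H413.F0P3cDyRamDiagonalTypeTwoExclX59

end
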